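import Mathlib
import Literature.Analysis.FluidPDE.WholeSpaceIBP
import Literature.Analysis.FluidPDE.ClassicalSolutionCalculus
import Literature.Analysis.FluidPDE.VectorCalculusProofs
import Literature.Analysis.FluidPDE.VorticityStretching
import HarnessLib

/-!
# Crux `NoFrozenEddyCollapse` (stmt-NavierStokesRegularity-1431), line `SketchIdeator1`:
  STUB `stub_cokernelHelicity` (the helicity cokernel family `ψ_g = g(B) curl U`)

Helper file (lands `--supports stmt-NavierStokesRegularity-1431`) for the registered stub
`stub_cokernelHelicity` of the skeleton `NoFrozenEddyCollapse` (card `shell-balance-edge-torsion`).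

Let `(U, P)` be a smooth, compactly supported steady Euler flow on `ℝ³` (`DU·U + ∇P = 0`,
`div U = 0`), `ω = curl U` its vorticity, `B = P + ‖U‖²/2` its Bernoulli head and `g : ℝ → ℝ`
smooth.  The field `ψ_g = g(B) ω` is smooth, compactly supported inside `tsupport U`, divergence
free, and for every `C¹` divergence-free `W` (no decay assumed)
`∫ (⟪U, Dψ_g W⟫ + ⟪W, Dψ_g U⟫) = 0`.

Proof outline.
* Linear algebra on `ℝ³`: for `L = DU(y)` and `ω = curl U (y)` (the axial vector of `L − Lᵀ`),
  `⟪b, L ω⟫ = ⟪L b, ω⟫` for every `b` (the difference is `⟪b, (L − Lᵀ) ω⟫ = ⟪b, ω × ω⟫ = 0`).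
* Bernoulli: `DB(y)v = DP(y)v + ⟪U, DU v⟫ = ⟪U, DU v⟫ − ⟪DU U, v⟫` (Euler: `∇P = −DU U`), so
  `DB·U = 0` and, by the linear algebra, `DB·ω = 0`; hence `D(g∘B)·U = D(g∘B)·ω = 0`.
* `div ψ_g = g(B) div ω + D(g∘B)·ω = 0` (`divergence_smul_apply`, `div curl = 0` is the tree's
  `divergence_curl_eq_zero_holds`).
* Steady vorticity equation `Dω·U = DU·ω`: the curl of `DU·U = −∇P` vanishes
  (`curl_gradient_eq_zero_holds`) and `curl ((U·∇)U) = (U·∇)ω − (ω·∇)U` for `div U = 0`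
  (`curl_convect_self_of_isDivFree`).
* Hence pointwise `Dψ_g·U = g(B) Dω·U = g(B) DU·ω` and `⟪W, Dψ_g U⟫ = g(B) ⟪W, DU ω⟫ =
  g(B) ⟪DU W, ω⟫ = ⟪DU W, ψ_g⟫`, so the pairing is `∫ (⟪U, Dψ_g W⟫ + ⟪DU W, ψ_g⟫) =
  −∫ div W ⟪U, ψ_g⟫ = 0` by the trilinear by-parts identity `integral_inner_convect_add_eq_zero`.
Mathlib + `Literature.Analysis.FluidPDE.{WholeSpaceIBP, VectorCalculusProofs, VorticityStretching}`.
-/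

noncomputable section

open MeasureTheory Set Filter Topology Metric Function
open scoped RealInnerProductSpace

namespace Summit.NavierStokesRegularity.NavierStokesRegularity.Theorems.NoFrozenEddyCollapse.ShellBalanceEdgeTorsion

open Literature.Analysis.FluidPDE

section Generic

variable {E : Type*} [NormedAddCommGroup E] [InnerProductSpace ℝ E]

/-- Derivative of the Bernoulli head `B = P + ‖U‖²/2`: `DB(y)v = DP(y)v + ⟪U y, DU(y)v⟫`. -/
private theorem fderiv_bernoulliHead_apply {U : E → E} {P : E → ℝ} (hU : Differentiable ℝ U)
    (hP : Differentiable ℝ P) (y v : E) :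
    fderiv ℝ (fun z => P z + ‖U z‖ ^ 2 / 2) y v = fderiv ℝ P y v + ⟪U y, fderiv ℝ U y v⟫ := by
  have hfun : (fun z => P z + ‖U z‖ ^ 2 / 2) = fun z => P z + ‖U z‖ ^ 2 * (2 : ℝ)⁻¹ := by
    funext z; ring
  rw [hfun, ((hP y).hasFDerivAt.fun_add ((hU y).hasFDerivAt.norm_sq.mul_const (2 : ℝ)⁻¹)).fderiv]
  simp only [_root_.add_apply, _root_.smul_apply, ContinuousLinearMap.comp_apply,
    innerSL_apply_apply, smul_eq_mul, nsmul_eq_mul, Nat.cast_ofNat]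
  ring

/-- The Bernoulli head is smooth when `U` and `P` are. -/
private theorem contDiff_bernoulliHead {U : E → E} {P : E → ℝ} {n : ℕ∞} (hU : ContDiff ℝ n U)
    (hP : ContDiff ℝ n P) : ContDiff ℝ n (fun z => P z + ‖U z‖ ^ 2 / 2) :=
  hP.add ((hU.norm_sq ℝ).div_const 2)

variable [FiniteDimensional ℝ E]

/-- **Bernoulli's theorem** for a steady Euler flow: the head is constant along streamlines,
`DB(y)(U y) = ⟪∇P(y) + DU(y)U(y), U(y)⟫ = 0`. -/
private theorem fderiv_bernoulliHead_apply_self {U : E → E} {P : E → ℝ} (hU : Differentiable ℝ U)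
    (hP : Differentiable ℝ P) (hE : ∀ x, convect U U x + gradient P x = 0) (y : E) :
    fderiv ℝ (fun z => P z + ‖U z‖ ^ 2 / 2) y (U y) = 0 := by
  have h1 : fderiv ℝ P y (U y) = ⟪gradient P y, U y⟫ := by
    rw [gradient, InnerProductSpace.toDual_symm_apply]
  have h2 : gradient P y = -convect U U y := eq_neg_of_add_eq_zero_right (hE y)
  rw [fderiv_bernoulliHead_apply hU hP, h1, h2, convect_apply, inner_neg_left,
    real_inner_comm (U y) (fderiv ℝ U y (U y)), neg_add_cancel]

variable [MeasurableSpace E] [BorelSpace E]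

/-- **The cokernel pairing by parts.** Let `U ∈ C¹`, `ψ ∈ C¹_c` and `W ∈ C¹` divergence free, and
suppose the pointwise identity `⟪W, Dψ U⟫ = ⟪DU W, ψ⟫`.  Then
`∫ (⟪U, Dψ W⟫ + ⟪W, Dψ U⟫) = ∫ (⟪U, (W·∇)ψ⟫ + ⟪(W·∇)U, ψ⟫) = -∫ div W ⟪U, ψ⟫ = 0`
(`integral_inner_convect_add_eq_zero`). -/
private theorem integral_pairing_eq_zero_of_pointwise {U W ψ : E → E} (hU : ContDiff ℝ 1 U)
    (hψ : ContDiff ℝ 1 ψ) (hψc : HasCompactSupport ψ) (hW : ContDiff ℝ 1 W)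
    (hWdiv : VectorCalculus.IsDivFree W)
    (hkey : ∀ y, ⟪W y, fderiv ℝ ψ y (U y)⟫ = ⟪fderiv ℝ U y (W y), ψ y⟫) :
    ∫ y, (⟪U y, fderiv ℝ ψ y (W y)⟫ + ⟪W y, fderiv ℝ ψ y (U y)⟫) = 0 := by
  -- by parts: `∫ ⟪DU W, ψ⟫ + ∫ ⟪U, Dψ W⟫ = 0`
  have hparts := integral_inner_convect_add_eq_zero hW hU hψ hψc
  have hW0 : ∀ x, VectorCalculus.divergence W x = 0 := hWdiv
  simp only [convect_apply, hW0, zero_mul, integral_zero, add_zero] at hparts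
  -- integrability (continuous integrands with compact support)
  have hiA : Integrable (fun y => ⟪U y, fderiv ℝ ψ y (W y)⟫) := by
    refine (hU.continuous.inner ((hψ.continuous_fderiv one_ne_zero).clm_apply hW.continuous))
      |>.integrable_of_hasCompactSupport ((hψc.fderiv (𝕜 := ℝ)).mono fun x hx => ?_)
    contrapose! hx
    simp only [mem_support, not_not] at hx ⊢
    simp [hx]
  have hiC : Integrable (fun y => ⟪fderiv ℝ U y (W y), ψ y⟫) := by
    refine (((hU.continuous_fderiv one_ne_zero).clm_apply hW.continuous).inner hψ.continuous)
      |>.integrable_of_hasCompactSupport (hψc.mono fun x hx => ?_)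
    contrapose! hx
    simp only [mem_support, not_not] at hx ⊢
    simp [hx]
  calc ∫ y, (⟪U y, fderiv ℝ ψ y (W y)⟫ + ⟪W y, fderiv ℝ ψ y (U y)⟫)
      = ∫ y, (⟪U y, fderiv ℝ ψ y (W y)⟫ + ⟪fderiv ℝ U y (W y), ψ y⟫) :=
        integral_congr_ae (Eventually.of_forall fun y => by beta_reduce; rw [hkey y])
    _ = (∫ y, ⟪U y, fderiv ℝ ψ y (W y)⟫) + ∫ y, ⟪fderiv ℝ U y (W y), ψ y⟫ := integral_add hiA hiC
    _ = 0 := by linarith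

end Generic

/-! ### Linear algebra on `ℝ³`: the vorticity is in the kernel of the spin matrix -/

/-- For a linear map `L` of `ℝ³` and its curl vector `c = curlCLM L` (the axial vector of the
antisymmetric part `L − Lᵀ`), `⟪b, L c⟫ = ⟪L b, c⟫` for every `b`: the difference is
`⟪b, (L − Lᵀ) c⟫ = ⟪b, c × c⟫ = 0` (Majda–Bertozzi, §1.4, (1.19)–(1.21), `Ω h = ½ ω × h`); checked
in coordinates. -/
private theorem inner_apply_curlCLM_comm
    (L : EuclideanSpace ℝ (Fin 3) →L[ℝ] EuclideanSpace ℝ (Fin 3)) (b : EuclideanSpace ℝ (Fin 3)) :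
    ⟪b, L (curlCLM L)⟫ = ⟪L b, curlCLM L⟫ := by
  simp only [PiLp.inner_apply, RCLike.inner_apply, conj_trivial, clm_apply_coord L b,
    clm_apply_coord L (curlCLM L)]
  simp only [curlCLM_apply, WithLp.ofLp_toLp, Fin.sum_univ_three, Matrix.cons_val_zero,
    Matrix.cons_val_one, Matrix.cons_val_two, Matrix.head_cons, Matrix.tail_cons]
  ring

/-- Field form of `inner_apply_curlCLM_comm`: `⟪b, DU(y) ω(y)⟫ = ⟪DU(y) b, ω(y)⟫` for
`ω = curl U` and every `b ∈ ℝ³` (no differentiability needed: `curl U y = curlCLM (DU(y))`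
definitionally). -/
private theorem inner_fderiv_apply_curl
    (U : EuclideanSpace ℝ (Fin 3) → EuclideanSpace ℝ (Fin 3)) (y b : EuclideanSpace ℝ (Fin 3)) :
    ⟪b, fderiv ℝ U y (curl U y)⟫ = ⟪fderiv ℝ U y b, curl U y⟫ := by
  rw [curl_eq_curlCLM]
  exact inner_apply_curlCLM_comm _ _

/-- **HELICITY COKERNEL FAMILY** (stub `stub_cokernelHelicity` of crux `NoFrozenEddyCollapse`, line
`SketchIdeator1`).  For a smooth compactly supported steady Euler flow `(U, P)` on `ℝ³`
(`DU·U + ∇P = 0`, `div U = 0`) and smooth `g : ℝ → ℝ`, the vortical Bernoulli-shell field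
`ψ_g = g(P + ‖U‖²/2) curl U` is smooth, compactly supported inside `tsupport U`, divergence free
(`div ψ_g = g(B) div curl U + g′(B) DB·ω = 0`, since `DB·ω = ⟪U, DU ω⟫ − ⟪DU U, ω⟫ = 0`), and
annihilated by the adjoint linearised Euler operator: `∫ (⟪U, Dψ_g W⟫ + ⟪W, Dψ_g U⟫) = 0` for
every `C¹` divergence-free `W` (pointwise `Dψ_g U = g(B) Dω U = g(B) DU ω` by Bernoulli and the
steady vorticity equation, so `⟪W, Dψ_g U⟫ = ⟪DU W, ψ_g⟫`, and then the pairing is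
`-∫ div W ⟪U, ψ_g⟫ = 0` by parts).  Uses: `ContDiff ⊤ U, P, g`, `HasCompactSupport U`,
`div U = 0`, the Euler equation. -/
theorem stub_cokernelHelicity :
    ∀ (U : EuclideanSpace ℝ (Fin 3) → EuclideanSpace ℝ (Fin 3)) (P : EuclideanSpace ℝ (Fin 3) → ℝ)
      (g : ℝ → ℝ),
      ContDiff ℝ (⊤ : ℕ∞) U → ContDiff ℝ (⊤ : ℕ∞) P → HasCompactSupport U →
      VectorCalculus.IsDivFree U → (∀ x, convect U U x + gradient P x = 0) → ContDiff ℝ (⊤ : ℕ∞) g →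
      ContDiff ℝ (⊤ : ℕ∞) (fun y => g (P y + ‖U y‖ ^ 2 / 2) • curl U y) ∧
        HasCompactSupport (fun y => g (P y + ‖U y‖ ^ 2 / 2) • curl U y) ∧
        tsupport (fun y => g (P y + ‖U y‖ ^ 2 / 2) • curl U y) ⊆ tsupport U ∧
        VectorCalculus.IsDivFree (fun y => g (P y + ‖U y‖ ^ 2 / 2) • curl U y) ∧
        ∀ W : EuclideanSpace ℝ (Fin 3) → EuclideanSpace ℝ (Fin 3), ContDiff ℝ 1 W →
          VectorCalculus.IsDivFree W →
          ∫ y, (inner ℝ (U y) (fderiv ℝ (fun z => g (P z + ‖U z‖ ^ 2 / 2) • curl U z) y (W y)) +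
            inner ℝ (W y) (fderiv ℝ (fun z => g (P z + ‖U z‖ ^ 2 / 2) • curl U z) y (U y))) = 0 := by
  intro U P g hU hP hUc hUdiv hEu hg
  -- regularity of `U`, `P`, `g`, the head `B`, `θ = g ∘ B`, the vorticity `ω` and `ψ = θ ω`
  have hU1 : ContDiff ℝ 1 U := hU.of_le (by exact_mod_cast le_top)
  have hU2 : ContDiff ℝ 2 U := hU.of_le (WithTop.coe_le_coe.2 le_top)
  have hP2 : ContDiff ℝ 2 P := hP.of_le (WithTop.coe_le_coe.2 le_top)
  have hUd : Differentiable ℝ U := hU1.differentiable one_ne_zero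
  have hPd : Differentiable ℝ P :=
    (hP.of_le (by exact_mod_cast le_top) : ContDiff ℝ 1 P).differentiable one_ne_zero
  have hgd : Differentiable ℝ g :=
    (hg.of_le (by exact_mod_cast le_top) : ContDiff ℝ 1 g).differentiable one_ne_zero
  have hB : ContDiff ℝ (⊤ : ℕ∞) (fun z => P z + ‖U z‖ ^ 2 / 2) := contDiff_bernoulliHead hU hP
  have hBd : Differentiable ℝ (fun z => P z + ‖U z‖ ^ 2 / 2) :=
    (hB.of_le (by exact_mod_cast le_top) : ContDiff ℝ 1 _).differentiable one_ne_zero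
  have hθ : ContDiff ℝ (⊤ : ℕ∞) (fun z => g (P z + ‖U z‖ ^ 2 / 2)) := hg.comp hB
  have hθd : Differentiable ℝ (fun z => g (P z + ‖U z‖ ^ 2 / 2)) :=
    (hθ.of_le (by exact_mod_cast le_top) : ContDiff ℝ 1 _).differentiable one_ne_zero
  have hω : ContDiff ℝ (⊤ : ℕ∞) (curl U) := contDiff_curl (n := (⊤ : ℕ∞)) (by exact_mod_cast hU)
  have hω1 : ContDiff ℝ 1 (curl U) := hω.of_le (by exact_mod_cast le_top)
  have hωd : Differentiable ℝ (curl U) := hω1.differentiable one_ne_zero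
  have hωc : HasCompactSupport (curl U) := hasCompactSupport_curl hUc
  have hωU : tsupport (curl U) ⊆ tsupport U :=
    closure_minimal (fun x hx => by
      contrapose! hx
      simp only [mem_support, not_not]
      exact curl_eq_zero_of_notMem_tsupport hx) (isClosed_tsupport U)
  have hψ : ContDiff ℝ (⊤ : ℕ∞) (fun y => g (P y + ‖U y‖ ^ 2 / 2) • curl U y) := hθ.smul hω
  have hψ1 : ContDiff ℝ 1 (fun y => g (P y + ‖U y‖ ^ 2 / 2) • curl U y) :=
    hψ.of_le (by exact_mod_cast le_top)
  have hψc : HasCompactSupport (fun y => g (P y + ‖U y‖ ^ 2 / 2) • curl U y) :=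
    hωc.mono (support_smul_subset_right (fun y => g (P y + ‖U y‖ ^ 2 / 2)) (curl U))
  -- Bernoulli: `DB·U = 0` and `DB·ω = 0`, hence `Dθ·U = Dθ·ω = 0`
  have hBU : ∀ y, fderiv ℝ (fun z => P z + ‖U z‖ ^ 2 / 2) y (U y) = 0 :=
    fderiv_bernoulliHead_apply_self hUd hPd hEu
  have hBω : ∀ y, fderiv ℝ (fun z => P z + ‖U z‖ ^ 2 / 2) y (curl U y) = 0 := fun y => by
    have h1 : fderiv ℝ P y (curl U y) = ⟪gradient P y, curl U y⟫ := by
      rw [gradient, InnerProductSpace.toDual_symm_apply]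
    have h2 : gradient P y = -convect U U y := eq_neg_of_add_eq_zero_right (hEu y)
    rw [fderiv_bernoulliHead_apply hUd hPd, h1, h2, convect_apply, inner_neg_left,
      inner_fderiv_apply_curl U y (U y), neg_add_cancel]
  have hθD : ∀ y v, fderiv ℝ (fun z => g (P z + ‖U z‖ ^ 2 / 2)) y v =
      deriv g (P y + ‖U y‖ ^ 2 / 2) * fderiv ℝ (fun z => P z + ‖U z‖ ^ 2 / 2) y v := fun y v => by
    have h : HasFDerivAt (fun z => g (P z + ‖U z‖ ^ 2 / 2))
        (deriv g (P y + ‖U y‖ ^ 2 / 2) • fderiv ℝ (fun z => P z + ‖U z‖ ^ 2 / 2) y) y :=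
      (hgd _).hasDerivAt.comp_hasFDerivAt y (hBd y).hasFDerivAt
    rw [h.fderiv, _root_.smul_apply, smul_eq_mul]
  have hθU : ∀ y, fderiv ℝ (fun z => g (P z + ‖U z‖ ^ 2 / 2)) y (U y) = 0 := fun y => by
    rw [hθD, hBU y, mul_zero]
  have hθω : ∀ y, fderiv ℝ (fun z => g (P z + ‖U z‖ ^ 2 / 2)) y (curl U y) = 0 := fun y => by
    rw [hθD, hBω y, mul_zero]
  -- the steady vorticity equation `Dω·U = DU·ω` (curl of `DU·U = -∇P`)
  have hvort : ∀ y, fderiv ℝ (curl U) y (U y) = fderiv ℝ U y (curl U y) := fun y => by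
    have h1 : curl (convect U U) y = 0 := by
      have hc : convect U U = fun x => -gradient P x :=
        funext fun x => eq_neg_of_add_eq_zero_left (hEu x)
      rw [hc, curl_neg, neg_eq_zero]
      exact curl_gradient_eq_zero_holds P hP2 y
    have h2 := curl_convect_self_of_isDivFree hU2 hUdiv y
    rw [h1, convect_apply, convect_apply, eq_comm, sub_eq_zero] at h2
    exact h2
  -- the pointwise identity `⟪W, Dψ U⟫ = ⟪DU W, ψ⟫`
  have hkey : ∀ (W : EuclideanSpace ℝ (Fin 3) → EuclideanSpace ℝ (Fin 3))
      (y : EuclideanSpace ℝ (Fin 3)),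
      ⟪W y, fderiv ℝ (fun z => g (P z + ‖U z‖ ^ 2 / 2) • curl U z) y (U y)⟫ =
        ⟪fderiv ℝ U y (W y), g (P y + ‖U y‖ ^ 2 / 2) • curl U y⟫ := fun W y => by
    rw [fderiv_fun_smul (hθd y) (hωd y)]
    simp only [_root_.add_apply, _root_.smul_apply, ContinuousLinearMap.smulRight_apply, hθU y,
      zero_smul, add_zero, hvort y, real_inner_smul_right, inner_fderiv_apply_curl U y (W y)]
  refine ⟨hψ, hψc, (tsupport_smul_subset_right (fun y => g (P y + ‖U y‖ ^ 2 / 2)) (curl U)).trans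
    hωU, ?_, ?_⟩
  · -- divergence free: `div (θ ω) = θ div ω + ⟪ω, ∇θ⟫ = 0 + Dθ·ω = 0`
    intro x
    rw [divergence_smul_apply (hθd x) (hωd x), divergence_curl_eq_zero_holds U hU2 x, mul_zero,
      zero_add, real_inner_comm, gradient, InnerProductSpace.toDual_symm_apply]
    exact hθω x
  · -- the cokernel identity
    intro W hW hWdiv
    exact integral_pairing_eq_zero_of_pointwise hU1 hψ1 hψc hW hWdiv (hkey W)

end Summit.NavierStokesRegularity.NavierStokesRegularity.Theorems.NoFrozenEddyCollapse.ShellBalanceEdgeTorsion
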